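import Mathlib
import Literature.NumberTheory.Transcendental.KZCalculusProofs
import Literature.NumberTheory.Transcendental.KZLogCalculusProofs
import Literature.NumberTheory.Transcendental.KZSemiCanonicalReductionProofs
import Literature.NumberTheory.Transcendental.KZRelationsLE
import Literature.NumberTheory.Transcendental.KZSubcalculusInvariants
import Summits.KontsevichZagierPeriods.KontsevichZagierPeriods.Theorems.MzvKernelInKZ.Negative.PiPolar

/-!
# Stub `stub_discClass` — crux `OffTetraSectorKernel`, line `odd-hyperbolic-ladder` (skeleton v7)

THE AREA OF THE DISC INSIDE THE CALCULUS: for a real algebraic constant `c`,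
`[D, c] ≡ [(0, 1), 4c/(1 + t²)]` modulo the Kontsevich–Zagier moves, `D` the open unit disc of `ℝ²`.

Proof. The integrand-`1` case is Kontsevich–Zagier's own first example `π = ∬_{x²+y²<1} = ∫ dt/(1+t²)`,
already carried out move by move in the tree (`MzvKernelInKZ.Negative.PiPolar`, `…PiLine`):
* the open disc differs from the punctured disc off the negative axis `Im` by the null segment
  `{y = 0}` (rule (1a), `KZ.of_sub_of_mem_relations_of_null`);
* `[Im, 1]` is ONE change of variables (the rational polar chart `(t, s) ↦ s·((1−t²)/(1+t²), 2t/(1+t²))`,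
  rule (2), `bandORep_sub_discImRep_mem_cov`) away from the band `[ℝ × (0,1), s·2/(1+t²)]`, whose closure
  (null difference, `bandC_sub_bandO_mem`) is ONE Newton–Leibniz move in the radius (rule (3), primitive
  `s²/(1+t²)`, `bandC_sub_line_mem_nl`) above the line `[ℝ, 1/(1+t²)]`;
* `[ℝ, 1/(1+t²)] ≡ 4 • [(0,1), 1/(1+t²)]` (`line_univ_sub_four_mem`: `t ↦ 1/t`, `t ↦ −t`, rules (1a), (2)),
  and `4 • [(0,1), 1/(1+t²)] ≡ [(0,1), 4/(1+t²)]` (rule (1b), `of_constMul_nat_sub_nsmul_mem_relations`).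
Finally the scaling endomorphism `[σ, f] ↦ [σ, c f]` preserves relations (`KZ.Equivalent.constMul`), and
the two ends are identified with `D` and `L` by rule (1) (`of_sub_of_mem_relations_of_null`,
`of_sub_of_mem_relations_of_eqOn`).

References: M. Kontsevich, D. Zagier, *Periods* (2001), §1.1 (first example), §1.2 rules (1)–(3).
-/

noncomputable section

open Set MeasureTheory
open Literature.NumberTheory.Transcendental

namespace Summit.KontsevichZagierPeriods.HyperbolicBloch.OffTetraSectorKernel

open Summit.KontsevichZagierPeriods.MzvKernelInKZ.Negative in
/-- **`[Im, 1] ≡ [(0,1), 4/(1+t²)]`**: the punctured unit disc off the negative axis with integrand `1`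
is move-equivalent to a representation on `(0, 1) ⊆ ℝ¹` with integrand `4 · 1/(1+t²)` (polar chart,
one Newton–Leibniz move in the radius, `[ℝ] ≡ 4 • [(0,1)]` for `dt/(1+t²)`, and integer scaling as
integrand additivity). [cite: KontsevichZagier2001, §1.1] -/
theorem discClass_exists_fourLine :
    ∃ M : KZ.IntegralRep 1, M.domain = {x | x 0 ∈ Ioo 0 1} ∧
      (M.integrand = fun x => 4 * (1 / (1 + x 0 ^ 2))) ∧
      KZ.of discImRep - KZ.of M ∈ KZ.relations := by
  have h1 : KZ.of bandORep - KZ.of discImRep ∈ KZ.relations :=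
    KZ.changeOfVariablesRel_subset_relations bandORep_sub_discImRep_mem_cov
  have h2 : KZ.of bandCRep - KZ.of bandORep ∈ KZ.relations := bandC_sub_bandO_mem
  have h3 : KZ.of bandCRep - KZ.of (lineRep univ sa_univ1) ∈ KZ.relations :=
    KZ.newtonLeibnizRel_subset_relations bandC_sub_line_mem_nl
  have h4 : KZ.of (lineRep univ sa_univ1) - 4 • KZ.of (lineRep L01 sa_L01) ∈ KZ.relations :=
    line_univ_sub_four_mem
  have h5 : KZ.of ((lineRep L01 sa_L01).constMul ((4 : ℕ) : ℝ) (isAlgebraic_nat 4)) -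
      4 • KZ.of (lineRep L01 sa_L01) ∈ KZ.relations :=
    (lineRep L01 sa_L01).of_constMul_nat_sub_nsmul_mem_relations 4
  refine ⟨(lineRep L01 sa_L01).constMul ((4 : ℕ) : ℝ) (isAlgebraic_nat 4), ?_, ?_, ?_⟩
  · ext x
    simp [lineRep, L01]
  · funext x
    simp [lineRep, hq]
  have : KZ.of discImRep - KZ.of ((lineRep L01 sa_L01).constMul ((4 : ℕ) : ℝ) (isAlgebraic_nat 4)) =
      -(KZ.of bandORep - KZ.of discImRep) - (KZ.of bandCRep - KZ.of bandORep) +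
      (KZ.of bandCRep - KZ.of (lineRep univ sa_univ1)) +
      (KZ.of (lineRep univ sa_univ1) - 4 • KZ.of (lineRep L01 sa_L01)) -
      (KZ.of ((lineRep L01 sa_L01).constMul ((4 : ℕ) : ℝ) (isAlgebraic_nat 4)) -
        4 • KZ.of (lineRep L01 sa_L01)) := by
    abel
  rw [this]
  exact sub_mem (add_mem (add_mem (sub_mem (neg_mem h1) h2) h3) h4) h5

open Summit.KontsevichZagierPeriods.MzvKernelInKZ.Negative in
/-- **STUB `stub_discClass`**: THE AREA OF THE DISC INSIDE THE CALCULUS. For real algebraic `c`,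
`[D, c] ≡ [(0, 1), 4c/(1 + t²)]` (`D` the open unit disc): Kontsevich–Zagier's first example
(`[Im, 1] ≡ [(0,1), 4/(1+t²)]`, `discClass_exists_fourLine`; the open disc exceeds `Im` by the null
segment `{y = 0, x ≤ 0}`), transported along the scaling endomorphism `[σ, f] ↦ [σ, c f]`
(`KZ.Equivalent.constMul`). [cite: KontsevichZagier2001, §1.1] -/
theorem stub_discClass :
    ∀ (c : ℝ), IsAlgebraic ℚ c →
    ∀ (D : KZ.IntegralRep 2), D.domain = {p | p 0 ^ 2 + p 1 ^ 2 < 1} → (∀ p ∈ D.domain, D.integrand p = c) →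
    ∀ (L : KZ.IntegralRep 1), L.domain = {x | x 0 ∈ Ioo 0 1} → (L.integrand = fun x => 4 * c / (1 + x 0 ^ 2)) →
      KZ.of D - KZ.of L ∈ KZ.relations := by
  intro c hc D hD hDi L hL hLi
  obtain ⟨M, hMd, hMi, hM⟩ := discClass_exists_fourLine
  -- the scaling endomorphism `[σ, f] ↦ [σ, c f]` preserves relations
  have hOM : KZ.of (discImRep.constMul c hc) - KZ.of (M.constMul c hc) ∈ KZ.relations :=
    KZ.Equivalent.constMul c hc (r := discImRep) (r' := M) hM
  -- `[D] ≡ [Im, c]`: the domains differ by a null set, the integrands agree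
  have hDO : KZ.of D - KZ.of (discImRep.constMul c hc) ∈ KZ.relations := by
    refine KZ.of_sub_of_mem_relations_of_null D _ ?_ ?_ ?_
    · have hsub : D.domain \ (discImRep.constMul c hc).domain ⊆ {z : Fin 2 → ℝ | z 1 = 0} := by
        intro p hp
        have hpD : p 0 ^ 2 + p 1 ^ 2 < 1 := by
          have h := hp.1
          rw [hD] at h
          exact h
        have hpn : ¬ (0 < p 0 ^ 2 + p 1 ^ 2 ∧ p 0 ^ 2 + p 1 ^ 2 < 1 ∧ ¬ (p 1 = 0 ∧ p 0 ≤ 0)) := hp.2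
        by_contra h1
        have h1' : p 1 ≠ 0 := h1
        refine hpn ⟨?_, hpD, fun h => h1' h.1⟩
        positivity
      exact measure_mono_null hsub (volume_line2 0)
    · have h0 : (discImRep.constMul c hc).domain \ D.domain = ∅ := by
        refine eq_empty_of_forall_notMem fun p hp => hp.2 ?_
        have hp1 : 0 < p 0 ^ 2 + p 1 ^ 2 ∧ p 0 ^ 2 + p 1 ^ 2 < 1 ∧ ¬ (p 1 = 0 ∧ p 0 ≤ 0) := hp.1
        rw [hD]
        exact hp1.2.1
      rw [h0, measure_empty]
    · intro p hp
      rw [hDi p hp.1]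
      simp [discImRep]
  -- `[(0,1), c · (4/(1+t²))] ≡ [L]`: one domain, equal integrands
  have hML : KZ.of (M.constMul c hc) - KZ.of L ∈ KZ.relations := by
    refine KZ.of_sub_of_mem_relations_of_eqOn ?_ fun x _ => ?_
    · rw [hL, KZ.IntegralRep.domain_constMul, hMd]
    · rw [hLi, KZ.IntegralRep.integrand_constMul, hMi]
      simp only
      rw [mul_one_div, mul_div_assoc', mul_comm c 4]
  have : KZ.of D - KZ.of L = (KZ.of D - KZ.of (discImRep.constMul c hc)) +
      (KZ.of (discImRep.constMul c hc) - KZ.of (M.constMul c hc)) +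
      (KZ.of (M.constMul c hc) - KZ.of L) := by
    abel
  rw [this]
  exact add_mem (add_mem hDO hOM) hML

end Summit.KontsevichZagierPeriods.HyperbolicBloch.OffTetraSectorKernel

end
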